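import Summits.BirchSwinnertonDyer.Rank1Residual.X12.JZeroThreeDescent
import Summits.BirchSwinnertonDyer.Rank1Residual.X12.InertCoreInstancesA
import Summits.BirchSwinnertonDyer.Rank1Residual.X12.InertCoreInstancesB
import HarnessLib

/-!
# K12r@3 (`j = 0`, CM by `ℚ(√−3)`, `ord_{s=1} L(E,s) = 1`, `p = 3` RAMIFIED): per-class kernel records (D)
# — `5292b1`, `5292c1`, `5292h1`, `5292i1`, `6075a1`, `6075b1`, `6075bd1`, `6075c1`
# (cell `bsd-print-cfram`, seat p4; window `N < 2·10⁴` of the leaf `WAllCornerFRamifiedAtThree`)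

HONEST FRAMING (cell `bsd-print-cfram`, run/shared/lean/pub/bsd-print-cfram/, D-0131 (2) print
tier; verbatim in every file of the seat): the cell works the partition leaf
`CornerF ∧ p ramified in the CM field K` (LADDER-BSD row K7r = B13; W-ALL row 12r) in PARTITION
currency — a leaf or a cell counts only when its theorem is in the kernel BY NAME. NO class-wide
theorem for the `p = 3` slice is in print (bsd-wall-cm K12R3-SCOPING-v1 §3); these are PER-CLASS
records, one per isogeny class of the window `N < 2·10⁴` not already booked through a printed
family (Kriz–Li sextic twists / cube sums: 13 classes), in the booking shape of
`X12/JZeroThreeDescent.lean` (`JZeroThree.bsdp_three_of_noThreeTorsion`, seam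
`X12.bsdp_of_sha_torsion_eq_zero` p220351). Definitions = Cremona's minimal models (data);
theorems only otherwise; no named fact; nothing about any curve is ASSERTED — the per-class inputs
enter as hypotheses: `hr` (`ord_{s=1} L(E,s) ≤ 1`; Cremona: `= 1`), `h0` (`Ш(E/ℚ)[3] = 0`: the
CERTIFICATE), `hq`/`hv` (`#Ш_an(E) = q`, `ord₃ q = 0`; Cremona: `#Ш_an = 1` on every member of every
class below). beyond-print: NO (certificate assembly).

THE CERTIFICATE behind `h0` (two engines, two seats, two code bases; numbers quoted per record):
the `3`-isogeny descent along `φ : E_k → E_{−27k}` (`E_k : y² = x³ + k` the `j = 0` member,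
kernel `⟨(0, ±√k)⟩`): `s_φ = dim_𝔽₃ Sel^φ(E_k)`, `s_φ̂ = dim_𝔽₃ Sel^φ̂(E_{−27k})`,
`m = rank + [k ∈ ℚ²] + [−3k ∈ ℚ²]`, `EXCESS = s_φ + s_φ̂ − m = dim Ш(E_k)[φ] + dim Ш(E_{−27k})[φ̂]`;
EXCESS `0` ⟹ `Ш(E_k)[3] = 0 = Ш(E_{−27k})[3]`. Engine 1: x1b `x12sel3.gp` (Kummer images in
`K(S′,3)`, `bnfcertify`d, local images to the printed size [Schaefer 1996 L.3.8 = BES 2020 Prop. 27],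
Cassels' Selmer-ratio identity and BES Prop. 28 checked on every edge), kit j101548 = j101531;
engine 2: sha-2 `iso3kum.gp` run by harvest-1, kit j103487 = j103505; the two engines agree on
`(s_φ, s_φ̂)` on all 1838 members of the 919 classes `N < 5·10⁵` (x1b X12-ROUTE.md §17, harvest-1
GEN 25). `Ш(E)[3] = 0` is a `ℚ`-isogeny invariant inside these classes only through BSD — the record
states it for Cremona's curve 1 (= a `j = 0` member `E_k` up to `ℚ`-isomorphism, `k` quoted), on
which both engines computed it directly.

Per record: model (new, or REUSED by name with its instances), `IsElliptic`, `IsGloballyMinimal`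
(Kraus–Silverman, kernel-decided), `j = 0`, the leaf cell `cornerF_three_<name>`, and
`bsdp_three_<name>` = `BSD(E, 3) ∧ #Ш(E/ℚ)[3^∞] = 1` under `hGZK`, `hr`, `h0`, `hq`, `hv`; the class
form is `JZeroThree.bsdp_three_of_isIsogenous_of_noThreeTorsion` on the same hypotheses.

References: `X12/JZeroThreeDescent.lean`; `X12/MillerStollRecords.lean` §1; `X12/InertCoreInstancesA.lean`
§0 (record conventions); [cite: Cremona1997, Table 1]; [cite: Miller2011LMS, §1 and Def. 1.1];
[cite: SilvermanAEC2009, VII.1 Remark 1.1 and X.4]; x1b `gen13/sel3j0/SEL3J0-MEMBERS-1838.tsv`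
(sha256 in that folder's SHA256SUMS).
-/

set_option autoImplicit false

noncomputable section

open scoped Classical

open WeierstrassCurve Literature.NumberTheory.EllipticCurves
  Literature.NumberTheory.EllipticCurves.ModularForms
  Literature.NumberTheory.EllipticCurves.Rank1Residual
  Literature.NumberTheory.EllipticCurves.Rank1Residual.Typed
  Literature.NumberTheory.EllipticCurves.Rank1Residual.X11RankOneCertificates
  Summit.BirchSwinnertonDyer.BirchSwinnertonDyer.Rank1Residual.X11RankOne
  Summit.BirchSwinnertonDyer.Rank1Residual.X11b

namespace Summit.BirchSwinnertonDyer.Rank1Residual.X12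

/-! ### `5292b1 @ 3` (class `5292b`, `N = 5292 = 2²·3³·7²`) -/
namespace Records
/-- Cremona `5292b1 = [0, 0, 0, 0, -67228]`: `y² = x³ − 67228` (`N = 5292 = 2²·3³·7²`, `j = 0`, CM by `ℤ[ζ₃]`;
`≅ E_k : y² = x³ + k` with `k = -67228`; Cremona: rank `1`, `#E(ℚ)_tors = 1`, `∏ c_ℓ = 3`,
`#Ш_an = 1`). [cite: Cremona1997, Table 1 (curve 5292b1)] -/
def c5292b1 : WeierstrassCurve ℚ := ⟨0, 0, 0, 0, -67228⟩

/-- `5292b1` is an elliptic curve (`Δ = -1952468921088 ≠ 0`). [cite: SilvermanAEC2009, III.1] -/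
instance isElliptic_c5292b1 : c5292b1.IsElliptic := by
  have h := isElliptic_of_discOf_ne_zero 0 0 0 0 (-67228) (by decide)
  norm_num at h; exact h

set_option maxRecDepth 100000 in
/-- `[0, 0, 0, 0, -67228]` is globally minimal (`Δ = -1952468921088`; Kraus–Silverman criterion, kernel-decided).
[cite: SilvermanAEC2009, VII.1 Remark 1.1 and VIII.8] -/
instance isGloballyMinimal_c5292b1 : c5292b1.IsGloballyMinimal := by
  have h := isGloballyMinimal_of_krausCriterion_bounded 0 0 0 0 (-67228)
    (by decide) (by decide) (by decide +kernel)
  norm_num at h; exact h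

/-- `j(5292b1) = 0` (`c₄ = 0`). [cite: Cremona1997, Table 1 (curve 5292b1)] -/
theorem c5292b1_j : c5292b1.j = 0 := by
  have hc4 : c5292b1.c₄ = 0 := by
    norm_num [c5292b1, WeierstrassCurve.c₄, WeierstrassCurve.b₂, WeierstrassCurve.b₄]
  rw [WeierstrassCurve.j, hc4]
  simp

end Records

/-- **`(5292b1, 3)` is a cell of the leaf `CornerF ∧ CMRamified` at `3`** (CM by `ℚ(√−3)`,
`r_an = 1`, `3` bad and ramified), given `ord_{s=1} L(E,s) = 1` (`hr`; Cremona). [folklore] -/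
theorem cornerF_three_c5292b1 (hr : Records.c5292b1.analyticRank = 1) : CornerF Records.c5292b1 3 :=
  JZeroThree.cornerF_three_of_j_eq_zero _ Records.c5292b1_j hr

/-- **`BSD(5292b1, 3)` and `#Ш(5292b1/ℚ)[3^∞] = 1`** from GZK (`hGZK`), `ord_{s=1} L(E,s) ≤ 1`
(`hr`), the two-engine `3`-isogeny-descent certificate `Ш(E/ℚ)[3] = 0` (`h0`; 5292b1: k = -67228, (s_φ, s_φ̂, m, EXCESS) = (0, 1, 1, 0); 5292b2: k = 1815156, (s_φ, s_φ̂, m, EXCESS) = (1, 0, 1, 0);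
engines x1b j101548 / sha-2 j103487, agreeing) and `#Ш_an = q`, `ord₃ q = 0` (`hq`, `hv`; Cremona
`#Ш_an`: 5292b1 1, 5292b2 1). PER CLASS; nothing asserted. [cite: Miller2011LMS, §1 and Def. 1.1]
[cite: Cremona1997, Table 1 (class 5292b)] -/
theorem bsdp_three_c5292b1 (hGZK : rank_eq_analyticRank_of_analyticRank_le_one)
    (hr : Records.c5292b1.analyticRank ≤ 1) (h0 : ∀ x : ↥Records.c5292b1.sha, 3 • x = 0 → x = 0)
    {q : ℚ} (hq : shaAn Records.c5292b1 = (q : ℂ)) (hv : padicValRat 3 q = 0) :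
    BSDp Records.c5292b1 3 ∧ Nat.card (AddCommGroup.primaryComponent Records.c5292b1.sha 3) = 1 :=
  JZeroThree.bsdp_three_of_noThreeTorsion _ hGZK hr h0 hq hv

/-! ### `5292c1 @ 3` (class `5292c`, `N = 5292 = 2²·3³·7²`) -/
namespace Records
/-- Cremona `5292c1 = [0, 0, 0, 0, -7]`: `y² = x³ − 7` (`N = 5292 = 2²·3³·7²`, `j = 0`, CM by `ℤ[ζ₃]`;
`≅ E_k : y² = x³ + k` with `k = -7`; Cremona: rank `1`, `#E(ℚ)_tors = 1`, `∏ c_ℓ = 3`,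
`#Ш_an = 1`). [cite: Cremona1997, Table 1 (curve 5292c1)] -/
def c5292c1 : WeierstrassCurve ℚ := ⟨0, 0, 0, 0, -7⟩

/-- `5292c1` is an elliptic curve (`Δ = -21168 ≠ 0`). [cite: SilvermanAEC2009, III.1] -/
instance isElliptic_c5292c1 : c5292c1.IsElliptic := by
  have h := isElliptic_of_discOf_ne_zero 0 0 0 0 (-7) (by decide)
  norm_num at h; exact h

set_option maxRecDepth 100000 in
/-- `[0, 0, 0, 0, -7]` is globally minimal (`Δ = -21168`; Kraus–Silverman criterion, kernel-decided).
[cite: SilvermanAEC2009, VII.1 Remark 1.1 and VIII.8] -/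
instance isGloballyMinimal_c5292c1 : c5292c1.IsGloballyMinimal := by
  have h := isGloballyMinimal_of_krausCriterion_bounded 0 0 0 0 (-7)
    (by decide) (by decide) (by decide +kernel)
  norm_num at h; exact h

/-- `j(5292c1) = 0` (`c₄ = 0`). [cite: Cremona1997, Table 1 (curve 5292c1)] -/
theorem c5292c1_j : c5292c1.j = 0 := by
  have hc4 : c5292c1.c₄ = 0 := by
    norm_num [c5292c1, WeierstrassCurve.c₄, WeierstrassCurve.b₂, WeierstrassCurve.b₄]
  rw [WeierstrassCurve.j, hc4]
  simp

end Records

/-- **`(5292c1, 3)` is a cell of the leaf `CornerF ∧ CMRamified` at `3`** (CM by `ℚ(√−3)`,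
`r_an = 1`, `3` bad and ramified), given `ord_{s=1} L(E,s) = 1` (`hr`; Cremona). [folklore] -/
theorem cornerF_three_c5292c1 (hr : Records.c5292c1.analyticRank = 1) : CornerF Records.c5292c1 3 :=
  JZeroThree.cornerF_three_of_j_eq_zero _ Records.c5292c1_j hr

/-- **`BSD(5292c1, 3)` and `#Ш(5292c1/ℚ)[3^∞] = 1`** from GZK (`hGZK`), `ord_{s=1} L(E,s) ≤ 1`
(`hr`), the two-engine `3`-isogeny-descent certificate `Ш(E/ℚ)[3] = 0` (`h0`; 5292c1: k = -7, (s_φ, s_φ̂, m, EXCESS) = (0, 1, 1, 0); 5292c2: k = 189, (s_φ, s_φ̂, m, EXCESS) = (1, 0, 1, 0);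
engines x1b j101548 / sha-2 j103487, agreeing) and `#Ш_an = q`, `ord₃ q = 0` (`hq`, `hv`; Cremona
`#Ш_an`: 5292c1 1, 5292c2 1). PER CLASS; nothing asserted. [cite: Miller2011LMS, §1 and Def. 1.1]
[cite: Cremona1997, Table 1 (class 5292c)] -/
theorem bsdp_three_c5292c1 (hGZK : rank_eq_analyticRank_of_analyticRank_le_one)
    (hr : Records.c5292c1.analyticRank ≤ 1) (h0 : ∀ x : ↥Records.c5292c1.sha, 3 • x = 0 → x = 0)
    {q : ℚ} (hq : shaAn Records.c5292c1 = (q : ℂ)) (hv : padicValRat 3 q = 0) :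
    BSDp Records.c5292c1 3 ∧ Nat.card (AddCommGroup.primaryComponent Records.c5292c1.sha 3) = 1 :=
  JZeroThree.bsdp_three_of_noThreeTorsion _ hGZK hr h0 hq hv

/-! ### `5292h1 @ 3` (class `5292h`, `N = 5292 = 2²·3³·7²`) -/
namespace Records
/-- Cremona `5292h1 = [0, 0, 0, 0, 196]`: `y² = x³ + 196` (`N = 5292 = 2²·3³·7²`, `j = 0`, CM by `ℤ[ζ₃]`;
`≅ E_k : y² = x³ + k` with `k = 196`; Cremona: rank `1`, `#E(ℚ)_tors = 3`, `∏ c_ℓ = 9`,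
`#Ш_an = 1`). [cite: Cremona1997, Table 1 (curve 5292h1)] -/
def c5292h1 : WeierstrassCurve ℚ := ⟨0, 0, 0, 0, 196⟩

/-- `5292h1` is an elliptic curve (`Δ = -16595712 ≠ 0`). [cite: SilvermanAEC2009, III.1] -/
instance isElliptic_c5292h1 : c5292h1.IsElliptic := by
  have h := isElliptic_of_discOf_ne_zero 0 0 0 0 196 (by decide)
  norm_num at h; exact h

set_option maxRecDepth 100000 in
/-- `[0, 0, 0, 0, 196]` is globally minimal (`Δ = -16595712`; Kraus–Silverman criterion, kernel-decided).
[cite: SilvermanAEC2009, VII.1 Remark 1.1 and VIII.8] -/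
instance isGloballyMinimal_c5292h1 : c5292h1.IsGloballyMinimal := by
  have h := isGloballyMinimal_of_krausCriterion_bounded 0 0 0 0 196
    (by decide) (by decide) (by decide +kernel)
  norm_num at h; exact h

/-- `j(5292h1) = 0` (`c₄ = 0`). [cite: Cremona1997, Table 1 (curve 5292h1)] -/
theorem c5292h1_j : c5292h1.j = 0 := by
  have hc4 : c5292h1.c₄ = 0 := by
    norm_num [c5292h1, WeierstrassCurve.c₄, WeierstrassCurve.b₂, WeierstrassCurve.b₄]
  rw [WeierstrassCurve.j, hc4]
  simp

end Records

/-- **`(5292h1, 3)` is a cell of the leaf `CornerF ∧ CMRamified` at `3`** (CM by `ℚ(√−3)`,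
`r_an = 1`, `3` bad and ramified), given `ord_{s=1} L(E,s) = 1` (`hr`; Cremona). [folklore] -/
theorem cornerF_three_c5292h1 (hr : Records.c5292h1.analyticRank = 1) : CornerF Records.c5292h1 3 :=
  JZeroThree.cornerF_three_of_j_eq_zero _ Records.c5292h1_j hr

/-- **`BSD(5292h1, 3)` and `#Ш(5292h1/ℚ)[3^∞] = 1`** from GZK (`hGZK`), `ord_{s=1} L(E,s) ≤ 1`
(`hr`), the two-engine `3`-isogeny-descent certificate `Ш(E/ℚ)[3] = 0` (`h0`; 5292h1: k = 196, (s_φ, s_φ̂, m, EXCESS) = (1, 1, 2, 0); 5292h2: k = -5292, (s_φ, s_φ̂, m, EXCESS) = (1, 1, 2, 0);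
engines x1b j101548 / sha-2 j103487, agreeing) and `#Ш_an = q`, `ord₃ q = 0` (`hq`, `hv`; Cremona
`#Ш_an`: 5292h1 1, 5292h2 1). PER CLASS; nothing asserted. [cite: Miller2011LMS, §1 and Def. 1.1]
[cite: Cremona1997, Table 1 (class 5292h)] -/
theorem bsdp_three_c5292h1 (hGZK : rank_eq_analyticRank_of_analyticRank_le_one)
    (hr : Records.c5292h1.analyticRank ≤ 1) (h0 : ∀ x : ↥Records.c5292h1.sha, 3 • x = 0 → x = 0)
    {q : ℚ} (hq : shaAn Records.c5292h1 = (q : ℂ)) (hv : padicValRat 3 q = 0) :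
    BSDp Records.c5292h1 3 ∧ Nat.card (AddCommGroup.primaryComponent Records.c5292h1.sha 3) = 1 :=
  JZeroThree.bsdp_three_of_noThreeTorsion _ hGZK hr h0 hq hv

/-! ### `5292i1 @ 3` (class `5292i`, `N = 5292 = 2²·3³·7²`) -/
namespace Records
/-- Cremona `5292i1 = [0, 0, 0, 0, 2401]`: `y² = x³ + 2401` (`N = 5292 = 2²·3³·7²`, `j = 0`, CM by `ℤ[ζ₃]`;
`≅ E_k : y² = x³ + k` with `k = 2401`; Cremona: rank `1`, `#E(ℚ)_tors = 3`, `∏ c_ℓ = 9`,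
`#Ш_an = 1`). [cite: Cremona1997, Table 1 (curve 5292i1)] -/
def c5292i1 : WeierstrassCurve ℚ := ⟨0, 0, 0, 0, 2401⟩

/-- `5292i1` is an elliptic curve (`Δ = -2490394032 ≠ 0`). [cite: SilvermanAEC2009, III.1] -/
instance isElliptic_c5292i1 : c5292i1.IsElliptic := by
  have h := isElliptic_of_discOf_ne_zero 0 0 0 0 2401 (by decide)
  norm_num at h; exact h

set_option maxRecDepth 100000 in
/-- `[0, 0, 0, 0, 2401]` is globally minimal (`Δ = -2490394032`; Kraus–Silverman criterion, kernel-decided).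
[cite: SilvermanAEC2009, VII.1 Remark 1.1 and VIII.8] -/
instance isGloballyMinimal_c5292i1 : c5292i1.IsGloballyMinimal := by
  have h := isGloballyMinimal_of_krausCriterion_bounded 0 0 0 0 2401
    (by decide) (by decide) (by decide +kernel)
  norm_num at h; exact h

/-- `j(5292i1) = 0` (`c₄ = 0`). [cite: Cremona1997, Table 1 (curve 5292i1)] -/
theorem c5292i1_j : c5292i1.j = 0 := by
  have hc4 : c5292i1.c₄ = 0 := by
    norm_num [c5292i1, WeierstrassCurve.c₄, WeierstrassCurve.b₂, WeierstrassCurve.b₄]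
  rw [WeierstrassCurve.j, hc4]
  simp

end Records

/-- **`(5292i1, 3)` is a cell of the leaf `CornerF ∧ CMRamified` at `3`** (CM by `ℚ(√−3)`,
`r_an = 1`, `3` bad and ramified), given `ord_{s=1} L(E,s) = 1` (`hr`; Cremona). [folklore] -/
theorem cornerF_three_c5292i1 (hr : Records.c5292i1.analyticRank = 1) : CornerF Records.c5292i1 3 :=
  JZeroThree.cornerF_three_of_j_eq_zero _ Records.c5292i1_j hr

/-- **`BSD(5292i1, 3)` and `#Ш(5292i1/ℚ)[3^∞] = 1`** from GZK (`hGZK`), `ord_{s=1} L(E,s) ≤ 1`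
(`hr`), the two-engine `3`-isogeny-descent certificate `Ш(E/ℚ)[3] = 0` (`h0`; 5292i1: k = 2401, (s_φ, s_φ̂, m, EXCESS) = (1, 1, 2, 0); 5292i2: k = -64827, (s_φ, s_φ̂, m, EXCESS) = (1, 1, 2, 0);
engines x1b j101548 / sha-2 j103487, agreeing) and `#Ш_an = q`, `ord₃ q = 0` (`hq`, `hv`; Cremona
`#Ш_an`: 5292i1 1, 5292i2 1). PER CLASS; nothing asserted. [cite: Miller2011LMS, §1 and Def. 1.1]
[cite: Cremona1997, Table 1 (class 5292i)] -/
theorem bsdp_three_c5292i1 (hGZK : rank_eq_analyticRank_of_analyticRank_le_one)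
    (hr : Records.c5292i1.analyticRank ≤ 1) (h0 : ∀ x : ↥Records.c5292i1.sha, 3 • x = 0 → x = 0)
    {q : ℚ} (hq : shaAn Records.c5292i1 = (q : ℂ)) (hv : padicValRat 3 q = 0) :
    BSDp Records.c5292i1 3 ∧ Nat.card (AddCommGroup.primaryComponent Records.c5292i1.sha 3) = 1 :=
  JZeroThree.bsdp_three_of_noThreeTorsion _ hGZK hr h0 hq hv

/-! ### `6075a1 @ 3` (class `6075a`, `N = 6075 = 3⁵·5²`) -/
namespace Records
/-! Model `c6075a1 = [0, 0, 1, 0, 7031]` (`y² + y = x³ + 7031`; `k = 450000`; Cremona: rank `1`, `#E(ℚ)_tors = 1`,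
`∏ c_ℓ = 1`, `#Ш_an = 1`) with its `IsElliptic` / `IsGloballyMinimal` instances is REUSED from
`InertCoreInstancesB.lean`. -/

/-- `j(6075a1) = 0` (`c₄ = 0`). [cite: Cremona1997, Table 1 (curve 6075a1)] -/
theorem c6075a1_j : c6075a1.j = 0 := by
  have hc4 : c6075a1.c₄ = 0 := by
    norm_num [c6075a1, WeierstrassCurve.c₄, WeierstrassCurve.b₂, WeierstrassCurve.b₄]
  rw [WeierstrassCurve.j, hc4]
  simp

end Records

/-- **`(6075a1, 3)` is a cell of the leaf `CornerF ∧ CMRamified` at `3`** (CM by `ℚ(√−3)`,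
`r_an = 1`, `3` bad and ramified), given `ord_{s=1} L(E,s) = 1` (`hr`; Cremona). [folklore] -/
theorem cornerF_three_c6075a1 (hr : Records.c6075a1.analyticRank = 1) : CornerF Records.c6075a1 3 :=
  JZeroThree.cornerF_three_of_j_eq_zero _ Records.c6075a1_j hr

/-- **`BSD(6075a1, 3)` and `#Ш(6075a1/ℚ)[3^∞] = 1`** from GZK (`hGZK`), `ord_{s=1} L(E,s) ≤ 1`
(`hr`), the two-engine `3`-isogeny-descent certificate `Ш(E/ℚ)[3] = 0` (`h0`; 6075a1: k = 450000, (s_φ, s_φ̂, m, EXCESS) = (0, 1, 1, 0); 6075a2: k = -12150000, (s_φ, s_φ̂, m, EXCESS) = (1, 0, 1, 0);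
engines x1b j101548 / sha-2 j103487, agreeing) and `#Ш_an = q`, `ord₃ q = 0` (`hq`, `hv`; Cremona
`#Ш_an`: 6075a1 1, 6075a2 1). PER CLASS; nothing asserted. [cite: Miller2011LMS, §1 and Def. 1.1]
[cite: Cremona1997, Table 1 (class 6075a)] -/
theorem bsdp_three_c6075a1 (hGZK : rank_eq_analyticRank_of_analyticRank_le_one)
    (hr : Records.c6075a1.analyticRank ≤ 1) (h0 : ∀ x : ↥Records.c6075a1.sha, 3 • x = 0 → x = 0)
    {q : ℚ} (hq : shaAn Records.c6075a1 = (q : ℂ)) (hv : padicValRat 3 q = 0) :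
    BSDp Records.c6075a1 3 ∧ Nat.card (AddCommGroup.primaryComponent Records.c6075a1.sha 3) = 1 :=
  JZeroThree.bsdp_three_of_noThreeTorsion _ hGZK hr h0 hq hv

/-! ### `6075b1 @ 3` (class `6075b`, `N = 6075 = 3⁵·5²`) -/
namespace Records
/-! Model `c6075b1 = [0, 0, 1, 0, 11]` (`y² + y = x³ + 11`; `k = 720`; Cremona: rank `1`, `#E(ℚ)_tors = 1`,
`∏ c_ℓ = 1`, `#Ш_an = 1`) with its `IsElliptic` / `IsGloballyMinimal` instances is REUSED from
`InertCoreInstancesB.lean`. -/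

/-- `j(6075b1) = 0` (`c₄ = 0`). [cite: Cremona1997, Table 1 (curve 6075b1)] -/
theorem c6075b1_j : c6075b1.j = 0 := by
  have hc4 : c6075b1.c₄ = 0 := by
    norm_num [c6075b1, WeierstrassCurve.c₄, WeierstrassCurve.b₂, WeierstrassCurve.b₄]
  rw [WeierstrassCurve.j, hc4]
  simp

end Records

/-- **`(6075b1, 3)` is a cell of the leaf `CornerF ∧ CMRamified` at `3`** (CM by `ℚ(√−3)`,
`r_an = 1`, `3` bad and ramified), given `ord_{s=1} L(E,s) = 1` (`hr`; Cremona). [folklore] -/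
theorem cornerF_three_c6075b1 (hr : Records.c6075b1.analyticRank = 1) : CornerF Records.c6075b1 3 :=
  JZeroThree.cornerF_three_of_j_eq_zero _ Records.c6075b1_j hr

/-- **`BSD(6075b1, 3)` and `#Ш(6075b1/ℚ)[3^∞] = 1`** from GZK (`hGZK`), `ord_{s=1} L(E,s) ≤ 1`
(`hr`), the two-engine `3`-isogeny-descent certificate `Ш(E/ℚ)[3] = 0` (`h0`; 6075b1: k = 720, (s_φ, s_φ̂, m, EXCESS) = (0, 1, 1, 0); 6075b2: k = -19440, (s_φ, s_φ̂, m, EXCESS) = (1, 0, 1, 0);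
engines x1b j101548 / sha-2 j103487, agreeing) and `#Ш_an = q`, `ord₃ q = 0` (`hq`, `hv`; Cremona
`#Ш_an`: 6075b1 1, 6075b2 1). PER CLASS; nothing asserted. [cite: Miller2011LMS, §1 and Def. 1.1]
[cite: Cremona1997, Table 1 (class 6075b)] -/
theorem bsdp_three_c6075b1 (hGZK : rank_eq_analyticRank_of_analyticRank_le_one)
    (hr : Records.c6075b1.analyticRank ≤ 1) (h0 : ∀ x : ↥Records.c6075b1.sha, 3 • x = 0 → x = 0)
    {q : ℚ} (hq : shaAn Records.c6075b1 = (q : ℂ)) (hv : padicValRat 3 q = 0) :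
    BSDp Records.c6075b1 3 ∧ Nat.card (AddCommGroup.primaryComponent Records.c6075b1.sha 3) = 1 :=
  JZeroThree.bsdp_three_of_noThreeTorsion _ hGZK hr h0 hq hv

/-! ### `6075bd1 @ 3` (class `6075bd`, `N = 6075 = 3⁵·5²`) -/
namespace Records
/-! Model `c6075bd1 = [0, 0, 1, 0, 1406]` (`y² + y = x³ + 1406`; `k = 90000`; Cremona: rank `1`, `#E(ℚ)_tors = 3`,
`∏ c_ℓ = 9`, `#Ш_an = 1`) with its `IsElliptic` / `IsGloballyMinimal` instances is REUSED from
`InertCoreInstancesB.lean`. -/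

/-- `j(6075bd1) = 0` (`c₄ = 0`). [cite: Cremona1997, Table 1 (curve 6075bd1)] -/
theorem c6075bd1_j : c6075bd1.j = 0 := by
  have hc4 : c6075bd1.c₄ = 0 := by
    norm_num [c6075bd1, WeierstrassCurve.c₄, WeierstrassCurve.b₂, WeierstrassCurve.b₄]
  rw [WeierstrassCurve.j, hc4]
  simp

end Records

/-- **`(6075bd1, 3)` is a cell of the leaf `CornerF ∧ CMRamified` at `3`** (CM by `ℚ(√−3)`,
`r_an = 1`, `3` bad and ramified), given `ord_{s=1} L(E,s) = 1` (`hr`; Cremona). [folklore] -/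
theorem cornerF_three_c6075bd1 (hr : Records.c6075bd1.analyticRank = 1) : CornerF Records.c6075bd1 3 :=
  JZeroThree.cornerF_three_of_j_eq_zero _ Records.c6075bd1_j hr

/-- **`BSD(6075bd1, 3)` and `#Ш(6075bd1/ℚ)[3^∞] = 1`** from GZK (`hGZK`), `ord_{s=1} L(E,s) ≤ 1`
(`hr`), the two-engine `3`-isogeny-descent certificate `Ш(E/ℚ)[3] = 0` (`h0`; 6075bd1: k = 90000, (s_φ, s_φ̂, m, EXCESS) = (0, 2, 2, 0); 6075bd2: k = -2430000, (s_φ, s_φ̂, m, EXCESS) = (2, 0, 2, 0);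
engines x1b j101548 / sha-2 j103487, agreeing) and `#Ш_an = q`, `ord₃ q = 0` (`hq`, `hv`; Cremona
`#Ш_an`: 6075bd1 1, 6075bd2 1). PER CLASS; nothing asserted. [cite: Miller2011LMS, §1 and Def. 1.1]
[cite: Cremona1997, Table 1 (class 6075bd)] -/
theorem bsdp_three_c6075bd1 (hGZK : rank_eq_analyticRank_of_analyticRank_le_one)
    (hr : Records.c6075bd1.analyticRank ≤ 1) (h0 : ∀ x : ↥Records.c6075bd1.sha, 3 • x = 0 → x = 0)
    {q : ℚ} (hq : shaAn Records.c6075bd1 = (q : ℂ)) (hv : padicValRat 3 q = 0) :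
    BSDp Records.c6075bd1 3 ∧ Nat.card (AddCommGroup.primaryComponent Records.c6075bd1.sha 3) = 1 :=
  JZeroThree.bsdp_three_of_noThreeTorsion _ hGZK hr h0 hq hv

/-! ### `6075c1 @ 3` (class `6075c`, `N = 6075 = 3⁵·5²`) -/
namespace Records
/-! Model `c6075c1 = [0, 0, 1, 0, 281]` (`y² + y = x³ + 281`; `k = 18000`; Cremona: rank `1`, `#E(ℚ)_tors = 1`,
`∏ c_ℓ = 2`, `#Ш_an = 1`) with its `IsElliptic` / `IsGloballyMinimal` instances is REUSED from
`InertCoreInstancesB.lean`. -/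

/-- `j(6075c1) = 0` (`c₄ = 0`). [cite: Cremona1997, Table 1 (curve 6075c1)] -/
theorem c6075c1_j : c6075c1.j = 0 := by
  have hc4 : c6075c1.c₄ = 0 := by
    norm_num [c6075c1, WeierstrassCurve.c₄, WeierstrassCurve.b₂, WeierstrassCurve.b₄]
  rw [WeierstrassCurve.j, hc4]
  simp

end Records

/-- **`(6075c1, 3)` is a cell of the leaf `CornerF ∧ CMRamified` at `3`** (CM by `ℚ(√−3)`,
`r_an = 1`, `3` bad and ramified), given `ord_{s=1} L(E,s) = 1` (`hr`; Cremona). [folklore] -/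
theorem cornerF_three_c6075c1 (hr : Records.c6075c1.analyticRank = 1) : CornerF Records.c6075c1 3 :=
  JZeroThree.cornerF_three_of_j_eq_zero _ Records.c6075c1_j hr

/-- **`BSD(6075c1, 3)` and `#Ш(6075c1/ℚ)[3^∞] = 1`** from GZK (`hGZK`), `ord_{s=1} L(E,s) ≤ 1`
(`hr`), the two-engine `3`-isogeny-descent certificate `Ш(E/ℚ)[3] = 0` (`h0`; 6075c1: k = 18000, (s_φ, s_φ̂, m, EXCESS) = (0, 1, 1, 0); 6075c2: k = -486000, (s_φ, s_φ̂, m, EXCESS) = (1, 0, 1, 0);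
engines x1b j101548 / sha-2 j103487, agreeing) and `#Ш_an = q`, `ord₃ q = 0` (`hq`, `hv`; Cremona
`#Ш_an`: 6075c1 1, 6075c2 1). PER CLASS; nothing asserted. [cite: Miller2011LMS, §1 and Def. 1.1]
[cite: Cremona1997, Table 1 (class 6075c)] -/
theorem bsdp_three_c6075c1 (hGZK : rank_eq_analyticRank_of_analyticRank_le_one)
    (hr : Records.c6075c1.analyticRank ≤ 1) (h0 : ∀ x : ↥Records.c6075c1.sha, 3 • x = 0 → x = 0)
    {q : ℚ} (hq : shaAn Records.c6075c1 = (q : ℂ)) (hv : padicValRat 3 q = 0) :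
    BSDp Records.c6075c1 3 ∧ Nat.card (AddCommGroup.primaryComponent Records.c6075c1.sha 3) = 1 :=
  JZeroThree.bsdp_three_of_noThreeTorsion _ hGZK hr h0 hq hv


end Summit.BirchSwinnertonDyer.Rank1Residual.X12

end
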